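import Mathlib
import Summits.AtomisticToContinuum.Crystallization.Theses.SquareWellLayerCake
import Literature.Geometry.DiscreteGeometry.DelaunaySubdivision
import Literature.Geometry.DiscreteGeometry.SolidAngleFraction
import Literature.Geometry.DiscreteGeometry.GirardSolidAngle
import Summits.AtomisticToContinuum.Crystallization.Theorems.SquareWellLayerCakeAveragedTwelveGhostFrame
import Summits.AtomisticToContinuum.Crystallization.Theorems.SquareWellLayerCakeAveragedTwelveVertexFlat
import Summits.AtomisticToContinuum.Crystallization.Theorems.SquareWellLayerCakeAveragedTwelveEdgeFlat
import Summits.AtomisticToContinuum.Crystallization.Theorems.SquareWellLayerCakeAveragedTwelveGirardCell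
import Summits.AtomisticToContinuum.Crystallization.Theorems.SquareWellLayerCakeAveragedTwelveAssemble
import Summits.AtomisticToContinuum.Crystallization.Theorems.SquareWellLayerCakeAveragedTwelveLensSix
import Summits.AtomisticToContinuum.Crystallization.Theorems.SquareWellLayerCakeAveragedTwelveTetGauge
import Summits.AtomisticToContinuum.Crystallization.Theorems.SquareWellLayerCakeAveragedTwelveTwoCells
import Summits.AtomisticToContinuum.Crystallization.Theorems.SquareWellLayerCakeAveragedTwelveQrRange
import Summits.AtomisticToContinuum.Crystallization.Theorems.SquareWellLayerCakeAveragedTwelveEdgeValence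
import Summits.AtomisticToContinuum.Crystallization.Theorems.SquareWellLayerCakeAveragedTwelveAllNear
import Summits.AtomisticToContinuum.Crystallization.Theorems.SquareWellLayerCakeAveragedTwelveFrameSep
import Summits.AtomisticToContinuum.Crystallization.Theorems.SquareWellLayerCakeAveragedTwelveAssembleSep
import Summits.AtomisticToContinuum.Crystallization.Theorems.SquareWellLayerCakeAveragedTwelveLensPin
import Summits.AtomisticToContinuum.Crystallization.Theorems.SquareWellLayerCakeAveragedTwelveNearTriangle
import Summits.AtomisticToContinuum.Crystallization.Theorems.SquareWellLayerCakeAveragedTwelveNearSimplex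
import Summits.AtomisticToContinuum.Crystallization.Theorems.SquareWellLayerCakeAveragedTwelveConverse
import Summits.AtomisticToContinuum.Crystallization.Theorems.SquareWellLayerCakeAveragedTwelveSixValentShort
import Summits.AtomisticToContinuum.Crystallization.Theorems.SquareWellLayerCakeAveragedTwelveLensFive
import HarnessLib

/-!
# Line `Sketch` (idea `par-five-delaunay-recount`) — crux `SquareWellLayerCake.AveragedTwelve`
(item stmt-AtomisticToContinuum-15806), lead 0, skeleton v1 (2026-08-16).

PAR-FIVE DELAUNAY RECOUNT.  Scale `d`, tolerance `ρ ≤ (57/50)·d`.  Put the `d`-separated point set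
`P = x(G)` inside a far GHOST FRAME `Γ` (`stub_ghostFrame`: every point of `P` is interior to
`conv (P ∪ Γ)`, every ghost farther than `max ρ d` from `P`) and take a Delaunay triangulation `K` of
`ω = P ∪ Γ` (tree: `exists_isDelaunayTriangulation`, proved).  At every `p ∈ P` (interior vertex) Euler on
the link sphere holds in the integer form `deg(p) − 12 = Σ_{z ∈ Nb p} (t_pz − 5)` (`t_pz` = number of cells
on the edge `pz`), obtained WITHOUT topology from the solid-angle partition of unity at `p`
(`stub_vertexFlat`, the tree's `solidAngleFlatness_proof` in complex form), the dihedral partition of unity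
around each edge `pz` (`stub_edgeFlat`, `dihedralFlatness_proof` in complex form) and Girard
(`stub_girardCell`, `solidAngleFraction_eq_dihedralFraction` in complex form): `T_p = 2·deg p − 4`,
`Σ_z t_pz = 3 T_p`.  Pairs of `P` at distance `≤ ρ < √2·d` are Gabriel pairs of `ω`, hence edges of `K`
(tree `pair_mem_of_gabriel` + Apollonius; proved inside `stub_assemble` by the lead), and ghosts are beyond
`ρ`, so `#{q ∈ P, q ≠ p, dist ≤ ρ} = deg(p) − fardeg(p)`.  Summing over `p ∈ P`, the crux is EQUIVALENT to the
residual integer inequality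
  `Σ_{p ∈ P} Σ_{z ∈ Nb p} (t_pz − 5 − [ρ < dist p z]) ≤ 0`  (`= 2Σ_near(t−5) + 2Σ_far,PP(t−6) + Σ_PΓ(t−6)`),
i.e. `T ≤ 5V + E_far`: near edges are scored against PAR FIVE, far edges against PAR SIX.  The line's one new
metric input is the LENS LEMMA `stub_lensSix` (a `d`-separated set has at most 6 points within `[d, ρ]` of both
ends of a near pair when `ρ ≤ 1.14 d`; two lens points subtend `≥ 58.43° > 360°/7` about the axis), and the
residual is registered CONDITIONED on it (`stub_residual : LensSix → Residual`) — the discharging of far-edge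
deficits `3c_f + 1.5h_f + u_f − 6` against near-edge slacks `5 − c_e` along Delaunay triangles (card §4) is the
open, crux-sized content and is held by the lead.

STATUS (skeleton v21, lead c1, 2026-08-17T20:05Z): the two v20 infrastructure stubs are LANDED — `stub_lensFive` (lens capacity five below √5/2 —
the ladder's lemma) p172880 and `stub_sixValentShort` (six-valent all-near edges are shorter than 1.13 d) p172775 (`*_holds` below); composition unchanged;
THE ONLY `sorry` IS AGAIN `stub_cellChargeSep`.
PREVIOUS STATUS (skeleton v19, 2026-08-17T06:10Z): LANDED and imported — stub_ghostFrame p128793, stub_vertexFlat p128861,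
stub_girardCell p128891, stub_edgeFlat p128982, stub_assemble p128960, stub_lensSix p129178 (now `*_holds` below);
RESHAPE v4 (tetrahedron gauge) and v10 (separated far frame): the one open crux-sized stub is now `stub_cellChargeSep` (total cell
charge ≤ 0 for Delaunay triangulations of a d-SEPARATED site set whose ghosts are farther than diam P + ρ from P); composition
`AveragedTwelve_of = stub_assembleSep stub_frameSep vertexFlat_holds edgeFlat_holds girardCell_holds tetGauge_holds stub_cellChargeSep`.
LANDED (17 modules; + lensPinning p131462, nearTriangle p135430, nearSimplex p135704, CONVERSE p141142 — `AveragedTwelve ↔ stub_cellChargeSep` is now formal: `cellChargeSep_iff` below): ghostFrame p128793, vertexFlat p128861, girardCell p128891, edgeFlat p128982, lensSix p129178, assemble p128960,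
tetGauge p129940, twoCellsPerFace p130209, qrDihedralRange p130556, edgeValence p130503, allNearVertex p130833, frameSep p130974,
gaugeSep + assembleSep p130966.  THE ONLY `sorry` LEFT IS `stub_cellChargeSep` (XL, lead; crux-equivalent).

Stubs of v1 (registered; `sorry` lives only in `stub_*`): `stub_ghostFrame` (E), `stub_vertexFlat` (M),
`stub_edgeFlat` (M), `stub_girardCell` (M), `stub_lensSix` (M), `stub_residual` (XL, lead),
`stub_assemble` (glue, lead: image/injectivity reduction `Fin N → P`, Delaunay existence, near-pair = Gabriel,
recount combinatorics, summation).  `AveragedTwelve_of` composes them into the crux BY NAME.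
-/

noncomputable section

open scoped BigOperators Classical

namespace Summit.AtomisticToContinuum.Crystallization.Cruxes.AveragedTwelve.ParFiveRecount

/-- **stub_ghostFrame** (E). GHOST FRAME: every finite point set of `ℝ³` lies in the interior of the convex hull of itself and finitely many extra points, all farther than any prescribed `R` from it (four vertices of a huge tetrahedron / six of an octahedron).
LANDED: `Summit.AtomisticToContinuum.Crystallization.Theorems.ParFiveRecountGhostFrame.stub_ghostFrame` — no longer a stub of this file. -/
theorem ghostFrame_holds : ∀ (P : Finset (EuclideanSpace ℝ (Fin 3))) (R : ℝ), ∃ Γ : Finset (EuclideanSpace ℝ (Fin 3)), (∀ g ∈ Γ, ∀ p ∈ P, R < dist g p) ∧ ((↑P : Set (EuclideanSpace ℝ (Fin 3))) ⊆ interior (convexHull ℝ (↑(P ∪ Γ) : Set (EuclideanSpace ℝ (Fin 3))))) :=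
  Summit.AtomisticToContinuum.Crystallization.Theorems.ParFiveRecountGhostFrame.stub_ghostFrame

/-- **stub_vertexFlat** (M). SOLID-ANGLE PARTITION OF UNITY IN COMPLEX FORM: in a triangulation `K` of a finite `ω ⊂ ℝ³`, at a site `v` interior to `conv ω` the unit-ball fractions of the apex cones of the cells (4-vertex simplices) through `v` sum to `1`.  Plumbing of the landed `Summit.AtomisticToContinuum.Crystallization.Theorems.solidAngleFlatness_proof` (item 13607) with the tree's star data `IsTriangulation.exists_ball_subset_biUnion_vertexStar`, `disjoint_interior_of_mem_vertexStar`, `linearIndependent_sub_of_mem_faces` (DelaunaySubdivision.lean).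
LANDED: `Summit.AtomisticToContinuum.Crystallization.Theorems.ParFiveRecountVertexFlat.stub_vertexFlat` — no longer a stub of this file. -/
theorem vertexFlat_holds : ∀ (ω : Finset (EuclideanSpace ℝ (Fin 3))) (K : Geometry.SimplicialComplex ℝ (EuclideanSpace ℝ (Fin 3))), Literature.Geometry.DiscreteGeometry.IsTriangulation (↑ω : Set (EuclideanSpace ℝ (Fin 3))) K → ∀ v ∈ ω, v ∈ interior (convexHull ℝ (↑ω : Set (EuclideanSpace ℝ (Fin 3)))) → ∀ (S : Finset (Finset (EuclideanSpace ℝ (Fin 3)))), (∀ t, t ∈ S ↔ t ∈ K.faces ∧ v ∈ t ∧ t.card = 4) → ∑ t ∈ S, Literature.Geometry.DiscreteGeometry.ballFraction v (Literature.Geometry.DiscreteGeometry.apexCone v (fun w : ↥((t).erase v) => (↑w : EuclideanSpace ℝ (Fin 3)) - v)) = 1 :=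
  Summit.AtomisticToContinuum.Crystallization.Theorems.ParFiveRecountVertexFlat.stub_vertexFlat

/-- **stub_edgeFlat** (M). DIHEDRAL PARTITION OF UNITY IN COMPLEX FORM: in a triangulation `K` of a finite `ω ⊂ ℝ³`, for an edge `{v, z}` of `K` with `v` interior to `conv ω` (so the midpoint of `vz` is interior: `Convex.combo_interior_closure_mem_interior`), the unit-ball fractions at `v` of the dihedral wedges of the cells through `v` and `z` sum to `1`.  Plumbing of the landed `dihedralFlatness_proof` (item 13608) with `IsTriangulation.exists_ball_subset_biUnion_edgeStar`, `disjoint_interior_of_mem_vertexStar`, `linearIndependent_sub_of_mem_faces`.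
LANDED: `Summit.AtomisticToContinuum.Crystallization.Theorems.ParFiveRecountEdgeFlat.stub_edgeFlat` — no longer a stub of this file. -/
theorem edgeFlat_holds : ∀ (ω : Finset (EuclideanSpace ℝ (Fin 3))) (K : Geometry.SimplicialComplex ℝ (EuclideanSpace ℝ (Fin 3))), Literature.Geometry.DiscreteGeometry.IsTriangulation (↑ω : Set (EuclideanSpace ℝ (Fin 3))) K → ∀ v ∈ ω, v ∈ interior (convexHull ℝ (↑ω : Set (EuclideanSpace ℝ (Fin 3)))) → ∀ (z : EuclideanSpace ℝ (Fin 3)), z ≠ v → ({v, z} : Finset (EuclideanSpace ℝ (Fin 3))) ∈ K.faces → ∀ (S : Finset (Finset (EuclideanSpace ℝ (Fin 3)))), (∀ t, t ∈ S ↔ t ∈ K.faces ∧ v ∈ t ∧ z ∈ t ∧ t.card = 4) → ∑ t ∈ S, Literature.Geometry.DiscreteGeometry.ballFraction v (Literature.Geometry.DiscreteGeometry.apexWedge v (z - v) (fun w : ↥(((t).erase v).erase z) => (↑w : EuclideanSpace ℝ (Fin 3)) - v)) = 1 :=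
  Summit.AtomisticToContinuum.Crystallization.Theorems.ParFiveRecountEdgeFlat.stub_edgeFlat

/-- **stub_girardCell** (M). GIRARD IN COMPLEX FORM: for a 4-vertex simplex `t` of a complex and a vertex `v ∈ t`, the solid-angle fraction of the apex cone at `v` is half the sum of the three dihedral fractions along the edges `vz`, `z ∈ t ∖ {v}`, minus a quarter — `solidAngleFraction_eq_dihedralFraction` (GirardSolidAngle.lean) after enumerating `t.erase v` (reindexing invariance of `apexCone` / `apexWedge`).
LANDED: `Summit.AtomisticToContinuum.Crystallization.Theorems.ParFiveRecountGirardCell.stub_girardCell` — no longer a stub of this file. -/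
theorem girardCell_holds : ∀ (K : Geometry.SimplicialComplex ℝ (EuclideanSpace ℝ (Fin 3))) (t : Finset (EuclideanSpace ℝ (Fin 3))), t ∈ K.faces → t.card = 4 → ∀ v ∈ t, Literature.Geometry.DiscreteGeometry.ballFraction v (Literature.Geometry.DiscreteGeometry.apexCone v (fun w : ↥((t).erase v) => (↑w : EuclideanSpace ℝ (Fin 3)) - v)) = (∑ z ∈ t.erase v, Literature.Geometry.DiscreteGeometry.ballFraction v (Literature.Geometry.DiscreteGeometry.apexWedge v (z - v) (fun w : ↥(((t).erase v).erase z) => (↑w : EuclideanSpace ℝ (Fin 3)) - v))) / 2 - 1 / 4 :=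
  Summit.AtomisticToContinuum.Crystallization.Theorems.ParFiveRecountGirardCell.stub_girardCell

/-- **stub_lensSix** (M). LENS CAPACITY SIX at the crux's ratio: if `d ≤ |xy| ≤ ρ ≤ (57/50)d`, a `d`-separated set of points each within `[d, ρ]` of BOTH `x` and `y` has at most `6` points.  Proof sketch: in cylindrical coordinates about the axis `xy` a lens point has `r² ≤ ρ² − (|h| + ℓ/2)²`, `|h| ≤ (ρ² − d²)/(2ℓ)`; two lens points at distance `≥ d` subtend an axial angle `θ` with `cos θ ≤ 1 − d²/(2(ρ² − ℓ²/4)) ≤ 0.5236 < cos(2π/7) = 0.6235` (AM–GM on `2rr'cos θ = r² + r'² − |πz − πz'|²`), and seven sorted axial gaps each `> 2π/7` exceed `2π` (pattern of `KissingNodeDegree.five_sorted_angles_false`).  Holds up to `ρ ≈ 1.256 d`; `≤ 5` needs `ρ < (√5/2) d` (rung 1, not this crux).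
LANDED: `Summit.AtomisticToContinuum.Crystallization.Theorems.ParFiveRecountLensSix.stub_lensSix` — no longer a stub of this file. -/
theorem lensSix_holds : ∀ (d ρ : ℝ), 0 < d → ρ ≤ 57 / 50 * d → ∀ (x y : EuclideanSpace ℝ (Fin 3)), d ≤ dist x y → dist x y ≤ ρ → ∀ (S : Finset (EuclideanSpace ℝ (Fin 3))), (∀ z ∈ S, d ≤ dist z x ∧ dist z x ≤ ρ ∧ d ≤ dist z y ∧ dist z y ≤ ρ) → (∀ z ∈ S, ∀ w ∈ S, z ≠ w → d ≤ dist z w) → S.card ≤ 6 :=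
  Summit.AtomisticToContinuum.Crystallization.Theorems.ParFiveRecountLensSix.stub_lensSix

/-- **stub_tetGauge** (M, reshape v4). THE TETRAHEDRON GAUGE of the recounted excess (bookkeeping only, no metric hypothesis): at every `p ∈ P` (interior), `t_pz = Σ_{cells τ ∋ p,z} 1` and `w_pz = w_pz · Σ_{τ ∋ p,z} df(τ,p,z)` (dihedral partition of unity, the LANDED `stub_edgeFlat`), so `Σ_{z ∈ Nb p}(t_pz − w_pz) = Σ_{τ ∋ p} (3 − Σ_{z ∈ τ∖p} w_pz·df(τ,p,z))` (swap the double sum as in `ParFiveRecountAssemble.recount_comb`; `w = 6` for far, `5` for near), and summing over `p ∈ P` and swapping again gives the per-cell form `Σ_τ Σ_{p ∈ τ ∩ P} (3 − Σ_z w·df)` — the charge `Ψ(τ)`/`−s(τ)` of the companion card regge-deficit-face-flow, here with ghosts (only real vertices `p ∈ P` are charged).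
LANDED: `Summit.AtomisticToContinuum.Crystallization.Theorems.ParFiveRecountTetGauge.stub_tetGauge` — no longer a stub of this file. -/
theorem tetGauge_holds : ∀ (ρ : ℝ) (ω P : Finset (EuclideanSpace ℝ (Fin 3))), P ⊆ ω → (↑P : Set (EuclideanSpace ℝ (Fin 3))) ⊆ interior (convexHull ℝ (↑ω : Set (EuclideanSpace ℝ (Fin 3)))) → ∀ (K : Geometry.SimplicialComplex ℝ (EuclideanSpace ℝ (Fin 3))), Literature.Geometry.DiscreteGeometry.IsTriangulation (↑ω : Set (EuclideanSpace ℝ (Fin 3))) K → ∀ (Nb : EuclideanSpace ℝ (Fin 3) → Finset (EuclideanSpace ℝ (Fin 3))), (∀ p ∈ P, ∀ z, z ∈ Nb p ↔ z ≠ p ∧ ({p, z} : Finset (EuclideanSpace ℝ (Fin 3))) ∈ K.faces) → ∀ (S : EuclideanSpace ℝ (Fin 3) → EuclideanSpace ℝ (Fin 3) → Finset (Finset (EuclideanSpace ℝ (Fin 3)))), (∀ p ∈ P, ∀ z ∈ Nb p, ∀ t, t ∈ S p z ↔ t ∈ K.faces ∧ p ∈ t ∧ z ∈ t ∧ t.card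 = 4) → ∀ (Cells : Finset (Finset (EuclideanSpace ℝ (Fin 3)))), (∀ t, t ∈ Cells ↔ t ∈ K.faces ∧ t.card = 4) → ((∑ p ∈ P, ∑ z ∈ Nb p, (((S p z).card : ℤ) - 5 - if ρ < dist p z then 1 else 0) : ℤ) : ℝ) = ∑ t ∈ Cells, ∑ p ∈ P.filter (fun p => p ∈ t), (3 - ∑ z ∈ (t).erase p, (if ρ < dist p z then (6 : ℝ) else 5) * Literature.Geometry.DiscreteGeometry.ballFraction p (Literature.Geometry.DiscreteGeometry.apexWedge p (z - p) (fun w : ↥(((t).erase p).erase z) => (↑w : EuclideanSpace ℝ (Fin 3)) - p))) :=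
  Summit.AtomisticToContinuum.Crystallization.Theorems.ParFiveRecountTetGauge.stub_tetGauge

/-- **stub_frameSep** (E, skeleton v10). SEPARATED FAR FRAME: a `d`-separated finite `P ⊂ ℝ³` extends to a `d`-separated finite `ω ⊇ P` whose extra points are farther than any prescribed `R` from `P` and such that every point of `P` is interior to `conv ω` (the six octahedron vertices `±L·eᵢ` of the landed `stub_ghostFrame`, which are pairwise `≥ L√2` apart).
LANDED: `Summit.AtomisticToContinuum.Crystallization.Theorems.ParFiveRecountFrameSep.stub_frameSep` — no longer a stub of this file. -/
theorem frameSep_holds : ∀ (P : Finset (EuclideanSpace ℝ (Fin 3))) (d R : ℝ), 0 < d → (∀ p ∈ P, ∀ q ∈ P, p ≠ q → d ≤ dist p q) → ∃ ω : Finset (EuclideanSpace ℝ (Fin 3)), P ⊆ ω ∧ (∀ a ∈ ω, ∀ b ∈ ω, a ≠ b → d ≤ dist a b) ∧ (∀ g ∈ ω, g ∉ P → ∀ p ∈ P, R < dist g p) ∧ ((↑P : Set (EuclideanSpace ℝ (Fin 3))) ⊆ interior (convexHull ℝ (↑ω : Set (EuclideanSpace ℝ (Fin 3))))) :=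
  Summit.AtomisticToContinuum.Crystallization.Theorems.ParFiveRecountFrameSep.stub_frameSep

/-- **stub_cellChargeSep** (XL — the crux-sized residue, held by the lead; skeleton v10 restatement of `stub_cellCharge` on SEPARATED FAR FRAMES). TOTAL CELL CHARGE IS NON-POSITIVE: for a finite `d`-separated `ω ⊂ ℝ³`, `P ⊆ ω` interior to `conv ω` with every other site farther than `diam P + ρ` from `P` (so beyond `ρ`), `ρ ≤ (57/50)d`, and ANY Delaunay triangulation `K` of `ω`, the total charge `Σ_τ Σ_{p ∈ τ ∩ P} (3 − Σ_{z ∈ τ∖p} w_pz·df(τ,p,z))` (`w = 6` if `ρ < |pz|` else `5`; `df` = dihedral fraction) is `≤ 0`. Given the landed recount / Gabriel / tetrahedron gauge this is EQUIVALENT TO THE CRUX (and, through the crux, to the v4 form `stub_cellCharge` with arbitrary admissible frames). Per cell it fails (quasi-regular tetrahedra are sources `+0.22…+0.32`), per vertex star it fails (icosahedral centre), on fcc/hcp/every Barlow stacking the face rule R* balances it exactly; the open content is a face flow / cluster isoperimetry of bounded radius, or the structural route (all-near alphabet, depth bound B*, rod lemma). -/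
theorem stub_cellChargeSep : ∀ (d ρ : ℝ), 0 < d → ρ ≤ 57 / 50 * d → ∀ (ω P : Finset (EuclideanSpace ℝ (Fin 3))), P ⊆ ω → (∀ a ∈ ω, ∀ b ∈ ω, a ≠ b → d ≤ dist a b) → (∀ g ∈ ω, g ∉ P → ∀ p ∈ P, ∀ q ∈ P, dist p q + ρ < dist g p) → (↑P : Set (EuclideanSpace ℝ (Fin 3))) ⊆ interior (convexHull ℝ (↑ω : Set (EuclideanSpace ℝ (Fin 3)))) → ∀ (K : Geometry.SimplicialComplex ℝ (EuclideanSpace ℝ (Fin 3))), Literature.Geometry.DiscreteGeometry.IsDelaunayTriangulation (↑ω : Set (EuclideanSpace ℝ (Fin 3))) K → ∀ (Cells : Finset (Finset (EuclideanSpace ℝ (Fin 3)))), (∀ t, t ∈ Cells ↔ t ∈ K.faces ∧ t.card = 4) → ∑ t ∈ Cells, ∑ p ∈ P.filter (fun p => p ∈ t), (3 - ∑ z ∈ (t).erase p, (if ρ < dist p z then (6 : ℝ) else 5) * Literature.Geometry.DiscreteGeometry.ballFraction p (Literature.Geometry.DiscreteGeometry.apexWedge p (z - p) (fun w : ↥(((t).erase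 p).erase z) => (↑w : EuclideanSpace ℝ (Fin 3)) - p))) ≤ 0 := by
  sorry

/-- **stub_gaugeSep** (S glue, lead; skeleton v11). The residual on separated frames from the tetrahedron-gauge identity and the cell-charge inequality (two lines).
LANDED: `Summit.AtomisticToContinuum.Crystallization.Theorems.ParFiveRecountAssembleSep.stub_gaugeSep` — no longer a stub of this file. -/
theorem gaugeSep_holds : (∀ (ρ : ℝ) (ω P : Finset (EuclideanSpace ℝ (Fin 3))), P ⊆ ω → (↑P : Set (EuclideanSpace ℝ (Fin 3))) ⊆ interior (convexHull ℝ (↑ω : Set (EuclideanSpace ℝ (Fin 3)))) → ∀ (K : Geometry.SimplicialComplex ℝ (EuclideanSpace ℝ (Fin 3))), Literature.Geometry.DiscreteGeometry.IsTriangulation (↑ω : Set (EuclideanSpace ℝ (Fin 3))) K → ∀ (Nb : EuclideanSpace ℝ (Fin 3) → Finset (EuclideanSpace ℝ (Fin 3))), (∀ p ∈ P, ∀ z, z ∈ Nb p ↔ z ≠ p ∧ ({p, z} : Finset (EuclideanSpace ℝ (Fin 3))) ∈ K.faces) → ∀ (S : EuclideanSpace ℝ (Fin 3) → EuclideanSpace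 ℝ (Fin 3) → Finset (Finset (EuclideanSpace ℝ (Fin 3)))), (∀ p ∈ P, ∀ z ∈ Nb p, ∀ t, t ∈ S p z ↔ t ∈ K.faces ∧ p ∈ t ∧ z ∈ t ∧ t.card = 4) → ∀ (Cells : Finset (Finset (EuclideanSpace ℝ (Fin 3)))), (∀ t, t ∈ Cells ↔ t ∈ K.faces ∧ t.card = 4) → ((∑ p ∈ P, ∑ z ∈ Nb p, (((S p z).card : ℤ) - 5 - if ρ < dist p z then 1 else 0) : ℤ) : ℝ) = ∑ t ∈ Cells, ∑ p ∈ P.filter (fun p => p ∈ t), (3 - ∑ z ∈ (t).erase p, (if ρ < dist p z then (6 : ℝ) else 5) * Literature.Geometry.DiscreteGeometry.ballFraction p (Literature.Geometry.DiscreteGeometry.apexWedge p (z - p) (fun w : ↥(((t).erase p).erase z) => (↑w : EuclideanSpace ℝ (Fin 3)) - p)))) → (∀ (d ρ : ℝ), 0 < d → ρ ≤ 57 / 50 * d → ∀ (ω P : Finset (EuclideanSpace ℝ (Fin 3))), P ⊆ ω → (∀ a ∈ ω, ∀ b ∈ ω, a ≠ b → d ≤ dist a b) → (∀ g ∈ ω,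 g ∉ P → ∀ p ∈ P, ∀ q ∈ P, dist p q + ρ < dist g p) → (↑P : Set (EuclideanSpace ℝ (Fin 3))) ⊆ interior (convexHull ℝ (↑ω : Set (EuclideanSpace ℝ (Fin 3)))) → ∀ (K : Geometry.SimplicialComplex ℝ (EuclideanSpace ℝ (Fin 3))), Literature.Geometry.DiscreteGeometry.IsDelaunayTriangulation (↑ω : Set (EuclideanSpace ℝ (Fin 3))) K → ∀ (Cells : Finset (Finset (EuclideanSpace ℝ (Fin 3)))), (∀ t, t ∈ Cells ↔ t ∈ K.faces ∧ t.card = 4) → ∑ t ∈ Cells, ∑ p ∈ P.filter (fun p => p ∈ t), (3 - ∑ z ∈ (t).erase p, (if ρ < dist p z then (6 : ℝ) else 5) * Literature.Geometry.DiscreteGeometry.ballFraction p (Literature.Geometry.DiscreteGeometry.apexWedge p (z - p) (fun w : ↥(((t).erase p).erase z) => (↑w : EuclideanSpace ℝ (Fin 3)) - p))) ≤ 0) → ∀ (d ρ : ℝ), 0 < d → ρ ≤ 57 / 50 * d → ∀ (ω P : Finset (EuclideanSpace ℝ (Fin 3))), P ⊆ ω → (∀ a ∈ ω, ∀ b ∈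 ω, a ≠ b → d ≤ dist a b) → (∀ g ∈ ω, g ∉ P → ∀ p ∈ P, ∀ q ∈ P, dist p q + ρ < dist g p) → (↑P : Set (EuclideanSpace ℝ (Fin 3))) ⊆ interior (convexHull ℝ (↑ω : Set (EuclideanSpace ℝ (Fin 3)))) → ∀ (K : Geometry.SimplicialComplex ℝ (EuclideanSpace ℝ (Fin 3))), Literature.Geometry.DiscreteGeometry.IsDelaunayTriangulation (↑ω : Set (EuclideanSpace ℝ (Fin 3))) K → ∀ (Nb : EuclideanSpace ℝ (Fin 3) → Finset (EuclideanSpace ℝ (Fin 3))), (∀ p ∈ P, ∀ z, z ∈ Nb p ↔ z ≠ p ∧ ({p, z} : Finset (EuclideanSpace ℝ (Fin 3))) ∈ K.faces) → ∀ (S : EuclideanSpace ℝ (Fin 3) → EuclideanSpace ℝ (Fin 3) → Finset (Finset (EuclideanSpace ℝ (Fin 3)))), (∀ p ∈ P, ∀ z ∈ Nb p, ∀ t, t ∈ S p z ↔ t ∈ K.faces ∧ p ∈ t ∧ z ∈ t ∧ t.card = 4) → ∑ p ∈ P, ∑ z ∈ Nb p, (((S p z).card : ℤ) - 5 - if ρ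 < dist p z then 1 else 0) ≤ 0 :=
  Summit.AtomisticToContinuum.Crystallization.Theorems.ParFiveRecountAssembleSep.stub_gaugeSep

/-- **stub_assembleSep** (M glue, lead; skeleton v10). Separated far frame → the two partitions of unity → Girard → tetrahedron gauge → total cell charge ≤ 0 on separated frames → the crux (proof: work/assemble/AssembleSep.lean, adapting the landed `ParFiveRecountAssemble.pointset_bound`).
LANDED: `Summit.AtomisticToContinuum.Crystallization.Theorems.ParFiveRecountAssembleSep.stub_assembleSep` — no longer a stub of this file. -/
theorem assembleSep_holds : (∀ (P : Finset (EuclideanSpace ℝ (Fin 3))) (d R : ℝ), 0 < d → (∀ p ∈ P, ∀ q ∈ P, p ≠ q → d ≤ dist p q) → ∃ ω : Finset (EuclideanSpace ℝ (Fin 3)), P ⊆ ω ∧ (∀ a ∈ ω, ∀ b ∈ ω, a ≠ b → d ≤ dist a b) ∧ (∀ g ∈ ω, g ∉ P → ∀ p ∈ P, R < dist g p) ∧ ((↑P : Set (EuclideanSpace ℝ (Fin 3))) ⊆ interior (convexHull ℝ (↑ω : Set (EuclideanSpace ℝ (Fin 3)))))) → (∀ (ω : Finset (EuclideanSpace ℝ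 (Fin 3))) (K : Geometry.SimplicialComplex ℝ (EuclideanSpace ℝ (Fin 3))), Literature.Geometry.DiscreteGeometry.IsTriangulation (↑ω : Set (EuclideanSpace ℝ (Fin 3))) K → ∀ v ∈ ω, v ∈ interior (convexHull ℝ (↑ω : Set (EuclideanSpace ℝ (Fin 3)))) → ∀ (S : Finset (Finset (EuclideanSpace ℝ (Fin 3)))), (∀ t, t ∈ S ↔ t ∈ K.faces ∧ v ∈ t ∧ t.card = 4) → ∑ t ∈ S, Literature.Geometry.DiscreteGeometry.ballFraction v (Literature.Geometry.DiscreteGeometry.apexCone v (fun w : ↥((t).erase v) => (↑w : EuclideanSpace ℝ (Fin 3)) - v)) = 1) → (∀ (ω : Finset (EuclideanSpace ℝ (Fin 3))) (K : Geometry.SimplicialComplex ℝ (EuclideanSpace ℝ (Fin 3))), Literature.Geometry.DiscreteGeometry.IsTriangulation (↑ω : Set (EuclideanSpace ℝ (Fin 3))) K → ∀ v ∈ ω, v ∈ interior (convexHull ℝ (↑ω : Set (EuclideanSpace ℝ (Fin 3)))) → ∀ (z : EuclideanSpace ℝ (Fin 3)), z ≠ v → ({v, z} : Finset (EuclideanSpace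 ℝ (Fin 3))) ∈ K.faces → ∀ (S : Finset (Finset (EuclideanSpace ℝ (Fin 3)))), (∀ t, t ∈ S ↔ t ∈ K.faces ∧ v ∈ t ∧ z ∈ t ∧ t.card = 4) → ∑ t ∈ S, Literature.Geometry.DiscreteGeometry.ballFraction v (Literature.Geometry.DiscreteGeometry.apexWedge v (z - v) (fun w : ↥(((t).erase v).erase z) => (↑w : EuclideanSpace ℝ (Fin 3)) - v)) = 1) → (∀ (K : Geometry.SimplicialComplex ℝ (EuclideanSpace ℝ (Fin 3))) (t : Finset (EuclideanSpace ℝ (Fin 3))), t ∈ K.faces → t.card = 4 → ∀ v ∈ t, Literature.Geometry.DiscreteGeometry.ballFraction v (Literature.Geometry.DiscreteGeometry.apexCone v (fun w : ↥((t).erase v) => (↑w : EuclideanSpace ℝ (Fin 3)) - v)) = (∑ z ∈ t.erase v, Literature.Geometry.DiscreteGeometry.ballFraction v (Literature.Geometry.DiscreteGeometry.apexWedge v (z - v) (fun w : ↥(((t).erase v).erase z) => (↑w : EuclideanSpace ℝ (Fin 3)) - v))) / 2 - 1 / 4) → (∀ (d ρ : ℝ), 0 < d → ρ ≤ 57 /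 50 * d → ∀ (ω P : Finset (EuclideanSpace ℝ (Fin 3))), P ⊆ ω → (∀ a ∈ ω, ∀ b ∈ ω, a ≠ b → d ≤ dist a b) → (∀ g ∈ ω, g ∉ P → ∀ p ∈ P, ∀ q ∈ P, dist p q + ρ < dist g p) → (↑P : Set (EuclideanSpace ℝ (Fin 3))) ⊆ interior (convexHull ℝ (↑ω : Set (EuclideanSpace ℝ (Fin 3)))) → ∀ (K : Geometry.SimplicialComplex ℝ (EuclideanSpace ℝ (Fin 3))), Literature.Geometry.DiscreteGeometry.IsDelaunayTriangulation (↑ω : Set (EuclideanSpace ℝ (Fin 3))) K → ∀ (Nb : EuclideanSpace ℝ (Fin 3) → Finset (EuclideanSpace ℝ (Fin 3))), (∀ p ∈ P, ∀ z, z ∈ Nb p ↔ z ≠ p ∧ ({p, z} : Finset (EuclideanSpace ℝ (Fin 3))) ∈ K.faces) → ∀ (S : EuclideanSpace ℝ (Fin 3) → EuclideanSpace ℝ (Fin 3) → Finset (Finset (EuclideanSpace ℝ (Fin 3)))), (∀ p ∈ P, ∀ z ∈ Nb p, ∀ t, t ∈ S p z ↔ t ∈ K.faces ∧ p ∈ t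 ∧ z ∈ t ∧ t.card = 4) → ∑ p ∈ P, ∑ z ∈ Nb p, (((S p z).card : ℤ) - 5 - if ρ < dist p z then 1 else 0) ≤ 0) → Summit.AtomisticToContinuum.Crystallization.Theses.SquareWellLayerCake.AveragedTwelve :=
  Summit.AtomisticToContinuum.Crystallization.Theorems.ParFiveRecountAssembleSep.stub_assembleSep

/-- **stub_twoCellsPerFace** (M, infrastructure for every face-flow refinement; reshape v4). INTERIOR TRIANGLES ARE SHARED BY EXACTLY TWO CELLS: in a triangulation `K` of a finite `ω ⊂ ℝ³`, a triangle `σ` of `K` (3 vertices) with a vertex interior to `conv ω` (so its open simplex is interior: convexity) is a face of exactly two cells (4-vertex simplices) of `K`. `≥ 2`: the cells through `σ` cover a neighbourhood of an open-simplex point `m` of `σ` (`IsTriangulation.biUnion_cells_mem_nhds` with `hrel`), and points on either side of the plane of `σ` near `m` lie in cells on that side; `≤ 2`: two cells on the same side of `σ` would have intersecting interiors (`disjoint_interior_convexHull`).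
LANDED: `Summit.AtomisticToContinuum.Crystallization.Theorems.ParFiveRecountTwoCells.stub_twoCellsPerFace` — no longer a stub of this file. -/
theorem twoCellsPerFace_holds : ∀ (ω : Finset (EuclideanSpace ℝ (Fin 3))) (K : Geometry.SimplicialComplex ℝ (EuclideanSpace ℝ (Fin 3))), Literature.Geometry.DiscreteGeometry.IsTriangulation (↑ω : Set (EuclideanSpace ℝ (Fin 3))) K → ∀ (σ : Finset (EuclideanSpace ℝ (Fin 3))), σ ∈ K.faces → σ.card = 3 → (∃ v ∈ σ, v ∈ interior (convexHull ℝ (↑ω : Set (EuclideanSpace ℝ (Fin 3))))) → ∀ (C : Finset (Finset (EuclideanSpace ℝ (Fin 3)))), (∀ t, t ∈ C ↔ t ∈ K.faces ∧ t.card = 4 ∧ σ ⊆ t) → C.card = 2 :=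
  Summit.AtomisticToContinuum.Crystallization.Theorems.ParFiveRecountTwoCells.stub_twoCellsPerFace

/-- **stub_qrDihedralRange** (M, infrastructure for the orphan / alphabet classification of every refinement; skeleton v6). QUASI-REGULAR DIHEDRAL RANGE: in a 4-vertex simplex all of whose six edge lengths lie in `[d, (57/50)d]`, every dihedral fraction lies in `(1/7, 1/4)`, i.e. every dihedral angle in `(51.43°, 90°)` (numerically `[58.42°, 87.85°]`). Lower bound = the lens-capacity inequality of the LANDED `ParFiveRecountLensSix.planar_inner_le` (`cos ≤ 3/5`, and `2π < 7·arccos(3/5)` = `two_pi_lt_seven_arccos`); upper bound: `⟨πu, πv⟩ ≥ d² − ℓ²/4 − ρ²/2 − (ρ² − d²)²/(4ℓ²) ≥ 0.008 d² > 0` (Apollonius for `|u − m|²`, `|h_u| ≤ (ρ² − d²)/(2ℓ)`, worst case `ℓ = ρ`). Consequence (not part of the stub): an interior edge all of whose cells are quasi-regular has valence 5 or 6, and an all-quasi-regular interior vertex has `deg = 12 + #(6-valent edges)`.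
LANDED: `Summit.AtomisticToContinuum.Crystallization.Theorems.ParFiveRecountQrRange.stub_qrDihedralRange` — no longer a stub of this file. -/
theorem qrDihedralRange_holds : ∀ (d : ℝ), 0 < d → ∀ (K : Geometry.SimplicialComplex ℝ (EuclideanSpace ℝ (Fin 3))) (t : Finset (EuclideanSpace ℝ (Fin 3))), t ∈ K.faces → t.card = 4 → (∀ a ∈ t, ∀ b ∈ t, a ≠ b → d ≤ dist a b ∧ dist a b ≤ 57 / 50 * d) → ∀ p ∈ t, ∀ z ∈ t.erase p, 1 / 7 < Literature.Geometry.DiscreteGeometry.ballFraction p (Literature.Geometry.DiscreteGeometry.apexWedge p (z - p) (fun w : ↥(((t).erase p).erase z) => (↑w : EuclideanSpace ℝ (Fin 3)) - p)) ∧ Literature.Geometry.DiscreteGeometry.ballFraction p (Literature.Geometry.DiscreteGeometry.apexWedge p (z - p) (fun w : ↥(((t).erase p).erase z) => (↑w : EuclideanSpace ℝ (Fin 3)) - p)) < 1 / 4 :=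
  Summit.AtomisticToContinuum.Crystallization.Theorems.ParFiveRecountQrRange.stub_qrDihedralRange

/-- **stub_edgeValence** (M, infrastructure for the edge gauge: par-five `t_e`, lens counts `c_e`, orphans; skeleton v8). CELLS ON AN INTERIOR EDGE = TRIANGLES ON IT: in a triangulation of a finite `ω ⊂ ℝ³`, for an edge `vz` with `v` interior to `conv ω`, the number of 4-vertex cells containing `v, z` equals the number of triangles (3-vertex simplices) containing `v, z` — double count the pairs (triangle `σ ⊇ {{v,z}}`, cell `t ⊇ σ`): each such triangle lies in exactly two cells (the LANDED `ParFiveRecountTwoCells.stub_twoCellsPerFace`, `v` being an interior vertex of `σ`) and each cell on `vz` contains exactly two such triangles (its two other vertices).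
LANDED: `Summit.AtomisticToContinuum.Crystallization.Theorems.ParFiveRecountEdgeValence.stub_edgeValence` — no longer a stub of this file. -/
theorem edgeValence_holds : ∀ (ω : Finset (EuclideanSpace ℝ (Fin 3))) (K : Geometry.SimplicialComplex ℝ (EuclideanSpace ℝ (Fin 3))), Literature.Geometry.DiscreteGeometry.IsTriangulation (↑ω : Set (EuclideanSpace ℝ (Fin 3))) K → ∀ v ∈ ω, v ∈ interior (convexHull ℝ (↑ω : Set (EuclideanSpace ℝ (Fin 3)))) → ∀ (z : EuclideanSpace ℝ (Fin 3)), z ≠ v → ({v, z} : Finset (EuclideanSpace ℝ (Fin 3))) ∈ K.faces → ∀ (S T : Finset (Finset (EuclideanSpace ℝ (Fin 3)))), (∀ t, t ∈ S ↔ t ∈ K.faces ∧ v ∈ t ∧ z ∈ t ∧ t.card = 4) → (∀ σ, σ ∈ T ↔ σ ∈ K.faces ∧ v ∈ σ ∧ z ∈ σ ∧ σ.card = 3) → S.card = T.card :=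
  Summit.AtomisticToContinuum.Crystallization.Theorems.ParFiveRecountEdgeValence.stub_edgeValence

/-- **stub_allNearVertex** (S glue, lead; skeleton v9). THE ALL-NEAR VERTEX THEOREM at ratio 57/50 (card (T2) at rung 2; `AllNearAlphabet` of idea skin-deep-polytetrahedra without the `{{12,14,15}}` classification): at an interior vertex `v` all of whose cells are quasi-regular, every edge valence `t_vz ∈ {{5, 6}}` and `deg v − 12 = #{{z : t_vz = 6}} ≥ 0` — from the landed recount (`recount_comb` + partitions of unity + Girard) and `stub_qrDihedralRange` (`4 < t_vz < 7`).
LANDED: `Summit.AtomisticToContinuum.Crystallization.Theorems.ParFiveRecountAllNear.stub_allNearVertex` — no longer a stub of this file. -/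
theorem allNearVertex_holds : ∀ (d : ℝ), 0 < d → ∀ (ω : Finset (EuclideanSpace ℝ (Fin 3))) (K : Geometry.SimplicialComplex ℝ (EuclideanSpace ℝ (Fin 3))), Literature.Geometry.DiscreteGeometry.IsTriangulation (↑ω : Set (EuclideanSpace ℝ (Fin 3))) K → ∀ v ∈ ω, v ∈ interior (convexHull ℝ (↑ω : Set (EuclideanSpace ℝ (Fin 3)))) → ∀ (Nb : Finset (EuclideanSpace ℝ (Fin 3))), (∀ z, z ∈ Nb ↔ z ≠ v ∧ ({v, z} : Finset (EuclideanSpace ℝ (Fin 3))) ∈ K.faces) → ∀ (Sv : Finset (Finset (EuclideanSpace ℝ (Fin 3)))), (∀ t, t ∈ Sv ↔ t ∈ K.faces ∧ v ∈ t ∧ t.card = 4) → (∀ t ∈ Sv, ∀ a ∈ t, ∀ b ∈ t, a ≠ b → d ≤ dist a b ∧ dist a b ≤ 57 / 50 * d) → (∀ z ∈ Nb, (Sv.filter (fun t => z ∈ t)).card = 5 ∨ (Sv.filter (fun t => z ∈ t)).card = 6) ∧ ((Nb.card : ℤ) - 12 = ((Nb.filter (fun z => (Sv.filter (fun t => z ∈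 t)).card = 6)).card : ℤ)) :=
  Summit.AtomisticToContinuum.Crystallization.Theorems.ParFiveRecountAllNear.stub_allNearVertex

/-- **stub_lensPinning** (M, infrastructure for the orphan classification — `compressed segments are SHORT bonds`; skeleton v13). LENS PINNING with a safe constant: if `(113/100)d ≤ |xy| ≤ ρ ≤ (57/50)d`, a `d`-separated set of points within `[d, ρ]` of both `x` and `y` has at most FIVE points (numerically six fit iff `|xy| ≤ 1.092d`; analytically at equal heights iff `|xy|² ≤ 4(ρ² − d²)`, i.e. `1.0947d`). Proof: as `stub_lensSix` with the sharper target `cos θ < 1/2` for the axial angle of two lens points: `(r² + r′² − rr′) + (h − h′)² ≤ ρ² − ℓ²/4 + (r − r′)²/2 + (3/4)s² − (ℓ/2)s ≤ ρ² − ℓ²/4 + 0.0167d² < d²` once `ℓ ≥ 1.13d` (`s = |h|+|h′| ≤ (ρ²−d²)/ℓ`, `(r−r′)² ≤ (ρ²−d²)²/(4d² − ℓ²)`), so six sorted gaps `> π/3` would exceed `2π`.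
LANDED: `Summit.AtomisticToContinuum.Crystallization.Theorems.ParFiveRecountLensPin.stub_lensPinning` — no longer a stub of this file. -/
theorem lensPinning_holds : ∀ (d ρ : ℝ), 0 < d → ρ ≤ 57 / 50 * d → ∀ (x y : EuclideanSpace ℝ (Fin 3)), 113 / 100 * d ≤ dist x y → dist x y ≤ ρ → ∀ (S : Finset (EuclideanSpace ℝ (Fin 3))), (∀ z ∈ S, d ≤ dist z x ∧ dist z x ≤ ρ ∧ d ≤ dist z y ∧ dist z y ≤ ρ) → (∀ z ∈ S, ∀ w ∈ S, z ≠ w → d ≤ dist z w) → S.card ≤ 5 :=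
  Summit.AtomisticToContinuum.Crystallization.Theorems.ParFiveRecountLensPin.stub_lensPinning

/-- **stub_nearTriangle** (M–L, infrastructure: makes quasi-regular cells and lens counts `c_e` INTRINSIC; skeleton v15). NEAR TRIANGLES ARE DELAUNAY: in a `d`-separated site set, three sites with pairwise distances `≤ (57/50)d` span a triangle of EVERY Delaunay triangulation. Proof: the triangle is acute (largest angle `< 90°`: `cos ≥ (1 + 1 − 1.2996)/2 > 0`), so its circumcentre `m` lies inside it with circumradius `R ≤ (max side)/√3`, `2R² ≤ 0.87 d² < d²`; every other site `x` is farther than `R` from `m` (else, with `s` a vertex making a non-obtuse angle at `m`, `|xs|² ≤ |xm|² + R² ≤ 2R² < d²`); then the Gabriel power argument of `eq_or_eq_of_gabriel` with three equidistant points (Huygens twice: `|m − c|² = Σλ_s|s − c|² − R² ≥ r² − R²`) shows that the simplex of `K` carrying `m` has all its weighted vertices among `a, b, c`, and by uniqueness of barycentric coordinates all three occur.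
LANDED: `Summit.AtomisticToContinuum.Crystallization.Theorems.ParFiveRecountNearTriangle.stub_nearTriangle` — no longer a stub of this file. -/
theorem nearTriangle_holds : ∀ (d : ℝ), 0 < d → ∀ (ω : Set (EuclideanSpace ℝ (Fin 3))) (K : Geometry.SimplicialComplex ℝ (EuclideanSpace ℝ (Fin 3))), Literature.Geometry.DiscreteGeometry.IsDelaunayTriangulation ω K → (∀ x ∈ ω, ∀ y ∈ ω, x ≠ y → d ≤ dist x y) → ∀ (a b c : EuclideanSpace ℝ (Fin 3)), a ∈ ω → b ∈ ω → c ∈ ω → a ≠ b → a ≠ c → b ≠ c → dist a b ≤ 57 / 50 * d → dist a c ≤ 57 / 50 * d → dist b c ≤ 57 / 50 * d → ({a, b, c} : Finset (EuclideanSpace ℝ (Fin 3))) ∈ K.faces :=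
  Summit.AtomisticToContinuum.Crystallization.Theorems.ParFiveRecountNearTriangle.stub_nearTriangle

/-- **stub_nearSimplex** (S glue, lead; skeleton v16). NEAR SIMPLICES ARE DELAUNAY — the uniform-weight corollary of the landed Huygens engine `ParFiveRecountNearTriangle.mem_faces_of_sum_mul_dist_sq_lt`: in a Delaunay triangulation of a `d`-separated `ω ⊂ ℝ³`, every non-empty set of at most four sites with pairwise distances `≤ (57/50)d` is a simplex (second moment about each of its points `≤ (3/4)(57/50)² d² < d²`). In particular QUASI-REGULAR TETRAHEDRA ARE CELLS OF EVERY DELAUNAY TRIANGULATION and the lens count `c_e` of a near edge is its number of common near neighbours — the objects of the edge gauge and of the all-near / alphabet statements are INTRINSIC (metric, `K`-independent).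
LANDED: `Summit.AtomisticToContinuum.Crystallization.Theorems.ParFiveRecountNearSimplex.stub_nearSimplex` — no longer a stub of this file. -/
theorem nearSimplex_holds : ∀ (d : ℝ), 0 < d → ∀ (ω : Set (EuclideanSpace ℝ (Fin 3))) (K : Geometry.SimplicialComplex ℝ (EuclideanSpace ℝ (Fin 3))), Literature.Geometry.DiscreteGeometry.IsDelaunayTriangulation ω K → (∀ x ∈ ω, ∀ y ∈ ω, x ≠ y → d ≤ dist x y) → ∀ (t : Finset (EuclideanSpace ℝ (Fin 3))), t.Nonempty → t.card ≤ 4 → (∀ a ∈ t, a ∈ ω) → (∀ a ∈ t, ∀ b ∈ t, dist a b ≤ 57 / 50 * d) → t ∈ K.faces :=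
  Summit.AtomisticToContinuum.Crystallization.Theorems.ParFiveRecountNearSimplex.stub_nearSimplex

/-- **stub_cellChargeSep_of_crux** (M glue, lead; skeleton v18). THE CONVERSE: the crux implies the open stub (total cell charge ≤ 0 on every separated far frame), by the landed tetrahedron gauge + Euler link recount + Gabriel near pairs (the cell-charge sum equals `Σ_{p∈P}(#ρ-close − 12)`) and the crux read on an enumeration `Fin #P ≃ P`. Together with the composition this CERTIFIES that `stub_cellChargeSep` is exactly crux-sized: `AveragedTwelve ↔ stub_cellChargeSep`.
LANDED: `Summit.AtomisticToContinuum.Crystallization.Theorems.ParFiveRecountConverse.stub_cellChargeSep_of_crux` — no longer a stub of this file. -/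
theorem cellChargeSep_of_crux_holds : Summit.AtomisticToContinuum.Crystallization.Theses.SquareWellLayerCake.AveragedTwelve → ∀ (d ρ : ℝ), 0 < d → ρ ≤ 57 / 50 * d → ∀ (ω P : Finset (EuclideanSpace ℝ (Fin 3))), P ⊆ ω → (∀ a ∈ ω, ∀ b ∈ ω, a ≠ b → d ≤ dist a b) → (∀ g ∈ ω, g ∉ P → ∀ p ∈ P, ∀ q ∈ P, dist p q + ρ < dist g p) → (↑P : Set (EuclideanSpace ℝ (Fin 3))) ⊆ interior (convexHull ℝ (↑ω : Set (EuclideanSpace ℝ (Fin 3)))) → ∀ (K : Geometry.SimplicialComplex ℝ (EuclideanSpace ℝ (Fin 3))), Literature.Geometry.DiscreteGeometry.IsDelaunayTriangulation (↑ω : Set (EuclideanSpace ℝ (Fin 3))) K → ∀ (Cells : Finset (Finset (EuclideanSpace ℝ (Fin 3)))), (∀ t, t ∈ Cells ↔ t ∈ K.faces ∧ t.card = 4) → ∑ t ∈ Cells, ∑ p ∈ P.filter (fun p => p ∈ t), (3 - ∑ z ∈ (t).erase p, (if ρ < dist p z then (6 : ℝ) else 5) * Literature.Geometry.DiscreteGeometry.ballFraction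 p (Literature.Geometry.DiscreteGeometry.apexWedge p (z - p) (fun w : ↥(((t).erase p).erase z) => (↑w : EuclideanSpace ℝ (Fin 3)) - p))) ≤ 0 :=
  Summit.AtomisticToContinuum.Crystallization.Theorems.ParFiveRecountConverse.stub_cellChargeSep_of_crux

/-- **stub_assemble** (glue, lead). From the ghost frame, the two partitions of unity, Girard and the residual inequality to the crux: reduce `x : Fin N → ℝ³`, `G` to the point set `P = x(G)` (injective on `G` by `d`-separation), frame it, triangulate `P ∪ Γ` (tree `exists_isDelaunayTriangulation`), recount at each `p ∈ P` (`T_p = 2 deg p − 4`, `Σ_z t_pz = 3T_p` from the three identities), identify near `K`-neighbours with `ρ`-close points of `P` (Gabriel: tree `pair_mem_of_gabriel` + Apollonius `dist_sq_add_dist_sq_eq_midpoint`; ghosts are beyond `ρ`), and sum.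
LANDED: `Summit.AtomisticToContinuum.Crystallization.Theorems.ParFiveRecountAssemble.stub_assemble` — no longer a stub of this file. -/
theorem assemble_holds : (∀ (P : Finset (EuclideanSpace ℝ (Fin 3))) (R : ℝ), ∃ Γ : Finset (EuclideanSpace ℝ (Fin 3)), (∀ g ∈ Γ, ∀ p ∈ P, R < dist g p) ∧ ((↑P : Set (EuclideanSpace ℝ (Fin 3))) ⊆ interior (convexHull ℝ (↑(P ∪ Γ) : Set (EuclideanSpace ℝ (Fin 3)))))) → (∀ (ω : Finset (EuclideanSpace ℝ (Fin 3))) (K : Geometry.SimplicialComplex ℝ (EuclideanSpace ℝ (Fin 3))), Literature.Geometry.DiscreteGeometry.IsTriangulation (↑ω : Set (EuclideanSpace ℝ (Fin 3))) K → ∀ v ∈ ω, v ∈ interior (convexHull ℝ (↑ω : Set (EuclideanSpace ℝ (Fin 3)))) → ∀ (S : Finset (Finset (EuclideanSpace ℝ (Fin 3)))), (∀ t, t ∈ S ↔ t ∈ K.faces ∧ v ∈ t ∧ t.card = 4) → ∑ t ∈ S, Literature.Geometry.DiscreteGeometry.ballFraction v (Literature.Geometry.DiscreteGeometry.apexCone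 v (fun w : ↥((t).erase v) => (↑w : EuclideanSpace ℝ (Fin 3)) - v)) = 1) → (∀ (ω : Finset (EuclideanSpace ℝ (Fin 3))) (K : Geometry.SimplicialComplex ℝ (EuclideanSpace ℝ (Fin 3))), Literature.Geometry.DiscreteGeometry.IsTriangulation (↑ω : Set (EuclideanSpace ℝ (Fin 3))) K → ∀ v ∈ ω, v ∈ interior (convexHull ℝ (↑ω : Set (EuclideanSpace ℝ (Fin 3)))) → ∀ (z : EuclideanSpace ℝ (Fin 3)), z ≠ v → ({v, z} : Finset (EuclideanSpace ℝ (Fin 3))) ∈ K.faces → ∀ (S : Finset (Finset (EuclideanSpace ℝ (Fin 3)))), (∀ t, t ∈ S ↔ t ∈ K.faces ∧ v ∈ t ∧ z ∈ t ∧ t.card = 4) → ∑ t ∈ S, Literature.Geometry.DiscreteGeometry.ballFraction v (Literature.Geometry.DiscreteGeometry.apexWedge v (z - v) (fun w : ↥(((t).erase v).erase z) => (↑w : EuclideanSpace ℝ (Fin 3)) - v)) = 1) → (∀ (K : Geometry.SimplicialComplex ℝ (EuclideanSpace ℝ (Fin 3))) (t : Finset (EuclideanSpace ℝ (Fin 3))),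 t ∈ K.faces → t.card = 4 → ∀ v ∈ t, Literature.Geometry.DiscreteGeometry.ballFraction v (Literature.Geometry.DiscreteGeometry.apexCone v (fun w : ↥((t).erase v) => (↑w : EuclideanSpace ℝ (Fin 3)) - v)) = (∑ z ∈ t.erase v, Literature.Geometry.DiscreteGeometry.ballFraction v (Literature.Geometry.DiscreteGeometry.apexWedge v (z - v) (fun w : ↥(((t).erase v).erase z) => (↑w : EuclideanSpace ℝ (Fin 3)) - v))) / 2 - 1 / 4) → (∀ (d ρ : ℝ), 0 < d → ρ ≤ 57 / 50 * d → ∀ (ω P : Finset (EuclideanSpace ℝ (Fin 3))), P ⊆ ω → (∀ p ∈ P, ∀ q ∈ P, p ≠ q → d ≤ dist p q) → (∀ g ∈ ω, g ∉ P → ∀ p ∈ P, ρ < dist g p ∧ d ≤ dist g p) → (↑P : Set (EuclideanSpace ℝ (Fin 3))) ⊆ interior (convexHull ℝ (↑ω : Set (EuclideanSpace ℝ (Fin 3)))) → ∀ (K : Geometry.SimplicialComplex ℝ (EuclideanSpace ℝ (Fin 3))), Literature.Geometry.DiscreteGeometry.IsDelaunayTriangulation (↑ω : Set (EuclideanSpace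 ℝ (Fin 3))) K → ∀ (Nb : EuclideanSpace ℝ (Fin 3) → Finset (EuclideanSpace ℝ (Fin 3))), (∀ p ∈ P, ∀ z, z ∈ Nb p ↔ z ≠ p ∧ ({p, z} : Finset (EuclideanSpace ℝ (Fin 3))) ∈ K.faces) → ∀ (S : EuclideanSpace ℝ (Fin 3) → EuclideanSpace ℝ (Fin 3) → Finset (Finset (EuclideanSpace ℝ (Fin 3)))), (∀ p ∈ P, ∀ z ∈ Nb p, ∀ t, t ∈ S p z ↔ t ∈ K.faces ∧ p ∈ t ∧ z ∈ t ∧ t.card = 4) → ∑ p ∈ P, ∑ z ∈ Nb p, (((S p z).card : ℤ) - 5 - if ρ < dist p z then 1 else 0) ≤ 0) → Summit.AtomisticToContinuum.Crystallization.Theses.SquareWellLayerCake.AveragedTwelve :=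
  Summit.AtomisticToContinuum.Crystallization.Theorems.ParFiveRecountAssemble.stub_assemble

/-- **stub_lensFive** (M, infrastructure for the ratio ladder / rung 17/16 and for the structure theory of
6-valent near edges; skeleton v20, lead c1). LENS CAPACITY FIVE BELOW `√5/2`: if `d ≤ |xy| ≤ ρ < (√5/2)·d`, a
`d`-separated set of points each within `[d, ρ]` of BOTH `x` and `y` has at most FIVE points. Proof: exactly the
frame of the landed `ParFiveRecountLensSix` (`lens_point_bounds`, `planar_inner_le`'s estimate
`2P ≤ (3/5)(u+u') + (4/5)(ρ² − ℓ²/4) − d²`) with the sharper target `P < r r'/2` (`cos θ < 1/2`), which holds iff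
`ρ² − ℓ²/4 < d²`, i.e. whenever `ρ² < d² + ℓ²/4` — guaranteed by `ρ² < (5/4)d²` and `ℓ ≥ d`; then six sorted axial
gaps `> π/3` would exceed `2π` (pattern of `ParFiveRecountLensPin.card_le_five_of_lens_coords`). Sharp: the flat unit
hexagon at mid-height of a unit axis has `|zx| = |zy| = √5/2`. Consequence (not part of the stub): below ratio `√5/2`
an interior vertex all of whose cells are quasi-regular has exactly 12 neighbours (`stub_allNearVertex`).
LANDED: `Summit.AtomisticToContinuum.Crystallization.Theorems.ParFiveRecountLensFive.stub_lensFive` (p172880, lead c1 wave 1) — no longer a stub of this file. -/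
theorem lensFive_holds : ∀ (d ρ : ℝ), 0 < d → ρ < Real.sqrt 5 / 2 * d → ∀ (x y : EuclideanSpace ℝ (Fin 3)), d ≤ dist x y → dist x y ≤ ρ → ∀ (S : Finset (EuclideanSpace ℝ (Fin 3))), (∀ z ∈ S, d ≤ dist z x ∧ dist z x ≤ ρ ∧ d ≤ dist z y ∧ dist z y ≤ ρ) → (∀ z ∈ S, ∀ w ∈ S, z ≠ w → d ≤ dist z w) → S.card ≤ 5 :=
  Summit.AtomisticToContinuum.Crystallization.Theorems.ParFiveRecountLensFive.stub_lensFive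

/-- **stub_sixValentShort** (S–M, infrastructure for the structure theory of positive charge — `OrphanIsCompressedSegment`
of idea skin-deep-polytetrahedra; skeleton v20, lead c1). SIX-VALENT ALL-NEAR EDGES ARE SHORT: in a triangulation `K` of a
finite `d`-separated `ω ⊂ ℝ³`, an edge `vz` with `v` interior to `conv ω`, at least six cells on it, and all of whose cells
have their edges `≤ (57/50)d`, has length `< (113/100)d`. Proof: the cells on `vz` are as many as the triangles on `vz`
(landed `ParFiveRecountEdgeValence.stub_edgeValence`), each triangle `{v,z,x}` lies in a cell on `vz` (landed
`ParFiveRecountTwoCells.stub_twoCellsPerFace`, `v` interior), so the `≥ 6` third vertices `x` are pairwise `d`-separated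
points of `ω` within `[d, (57/50)d]` of both `v` and `z`; if `(113/100)d ≤ |vz|` the landed lens pinning
`ParFiveRecountLensPin.stub_lensPinning` allows at most five — contradiction.
LANDED: `Summit.AtomisticToContinuum.Crystallization.Theorems.ParFiveRecountSixValentShort.stub_sixValentShort` (p172775, lead c1 wave 1) — no longer a stub of this file. -/
theorem sixValentShort_holds : ∀ (d : ℝ), 0 < d → ∀ (ω : Finset (EuclideanSpace ℝ (Fin 3))) (K : Geometry.SimplicialComplex ℝ (EuclideanSpace ℝ (Fin 3))), Literature.Geometry.DiscreteGeometry.IsTriangulation (↑ω : Set (EuclideanSpace ℝ (Fin 3))) K → (∀ a ∈ ω, ∀ b ∈ ω, a ≠ b → d ≤ dist a b) → ∀ v ∈ ω, v ∈ interior (convexHull ℝ (↑ω : Set (EuclideanSpace ℝ (Fin 3)))) → ∀ (z : EuclideanSpace ℝ (Fin 3)), z ≠ v → ({v, z} : Finset (EuclideanSpace ℝ (Fin 3))) ∈ K.faces → ∀ (S : Finset (Finset (EuclideanSpace ℝ (Fin 3)))), (∀ t, t ∈ S ↔ t ∈ K.faces ∧ v ∈ t ∧ z ∈ t ∧ t.card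 = 4) → (∀ t ∈ S, ∀ a ∈ t, ∀ b ∈ t, dist a b ≤ 57 / 50 * d) → 6 ≤ S.card → dist v z < 113 / 100 * d :=
  Summit.AtomisticToContinuum.Crystallization.Theorems.ParFiveRecountSixValentShort.stub_sixValentShort

/-! ## Composition (no `sorry` below this line) -/

/-- **The open stub is exactly the crux.** `stub_cellChargeSep ↔ AveragedTwelve`: `→` is the composition of the line
(`stub_assembleSep ∘ stub_gaugeSep ∘ stub_tetGauge` with the landed frame / flatness / Girard), `←` is the landed converse
`ParFiveRecountConverse.stub_cellChargeSep_of_crux`. -/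
theorem cellChargeSep_iff : (∀ (d ρ : ℝ), 0 < d → ρ ≤ 57 / 50 * d → ∀ (ω P : Finset (EuclideanSpace ℝ (Fin 3))), P ⊆ ω → (∀ a ∈ ω, ∀ b ∈ ω, a ≠ b → d ≤ dist a b) → (∀ g ∈ ω, g ∉ P → ∀ p ∈ P, ∀ q ∈ P, dist p q + ρ < dist g p) → (↑P : Set (EuclideanSpace ℝ (Fin 3))) ⊆ interior (convexHull ℝ (↑ω : Set (EuclideanSpace ℝ (Fin 3)))) → ∀ (K : Geometry.SimplicialComplex ℝ (EuclideanSpace ℝ (Fin 3))), Literature.Geometry.DiscreteGeometry.IsDelaunayTriangulation (↑ω : Set (EuclideanSpace ℝ (Fin 3))) K → ∀ (Cells : Finset (Finset (EuclideanSpace ℝ (Fin 3)))), (∀ t, t ∈ Cells ↔ t ∈ K.faces ∧ t.card = 4) → ∑ t ∈ Cells, ∑ p ∈ P.filter (fun p => p ∈ t), (3 - ∑ z ∈ (t).erase p, (if ρ < dist p z then (6 : ℝ) else 5) * Literature.Geometry.DiscreteGeometry.ballFraction p (Literature.Geometry.DiscreteGeometry.apexWedge p (z - p) (fun w : ↥(((t).erase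 p).erase z) => (↑w : EuclideanSpace ℝ (Fin 3)) - p))) ≤ 0) ↔ Summit.AtomisticToContinuum.Crystallization.Theses.SquareWellLayerCake.AveragedTwelve :=
  ⟨fun h => assembleSep_holds frameSep_holds vertexFlat_holds edgeFlat_holds girardCell_holds (gaugeSep_holds tetGauge_holds h),
   cellChargeSep_of_crux_holds⟩


/-- **The crux from the stubs, by name** (skeleton v10). `AveragedTwelve` (item stmt-AtomisticToContinuum-15806)
follows from `stub_frameSep`, the landed `stub_vertexFlat`, `stub_edgeFlat`, `stub_girardCell`, `stub_tetGauge` and the one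
open crux-sized stub `stub_cellChargeSep`, through the glue `stub_assembleSep`.  (The v1 path `assemble_holds … residual`
and the landed `ghostFrame_holds`, `lensSix_holds`, `twoCellsPerFace`, `qrDihedralRange`, `edgeValence`, `allNearVertex` are
infrastructure for the refinements and are not on this path.) -/
theorem AveragedTwelve_of : Summit.AtomisticToContinuum.Crystallization.Theses.SquareWellLayerCake.AveragedTwelve :=
  assembleSep_holds frameSep_holds vertexFlat_holds edgeFlat_holds girardCell_holds
    (gaugeSep_holds tetGauge_holds stub_cellChargeSep)

end Summit.AtomisticToContinuum.Crystallization.Cruxes.AveragedTwelve.ParFiveRecount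

end
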